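import Mathlib.RingTheory.Nullstellensatz
import Mathlib.RingTheory.KrullDimension.Basic
import Mathlib.RingTheory.Ideal.Quotient.Basic
import Mathlib.LinearAlgebra.Matrix.Rank
import Mathlib.Algebra.Field.Subfield.Basic
import Literature.ModelTheory.ExponentialFields.Languages
import HarnessLib

-- provenance: harness21/H21/H21/Prelude/TranscendKaehlerL/ExpVarieties.lean @ 0b8d21e (interim HEAD d8f2665); M5 mechanical rewrite
/-!
# Varieties in `Kⁿ × (Kˣ)ⁿ` for Zilber's pseudo-exponentiation (trunk TranscendKaehlerL, C4)

This file provides the *algebraic-geometry half* of the vocabulary of Zilber's axioms for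
pseudo-exponential fields (Zilber 2005, §§1–3; Kirby 2013, §2; Bays–Kirby 2018, §2;
Marker 2006 survey): subsets `V ⊆ Kⁿ × (Kˣ)ⁿ`, their Zariski dimension, irreducibility,
field of definition, generic points, the action of integer matrices `M ∈ Mₙ(ℤ)`
(additively on the first `n` coordinates, multiplicatively on the last `n`), rotundity,
additive/multiplicative freeness, and the graph of exponentiation.

## Design

* Points of `Kⁿ × (Kˣ)ⁿ` are functions `z : Fin n ⊕ Fin n → K`; the first block `z ∘ Sum.inl` is
  the additive part and `z ∘ Sum.inr` the multiplicative part. The condition "the last `n`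
  coordinates are nonzero" is the predicate `torusLocus`; it is *not* baked into the type so that
  Mathlib's affine Nullstellensatz API (`MvPolynomial.zeroLocus`, `MvPolynomial.vanishingIdeal`,
  two-field version with coefficient field `k` and point field `K`) applies verbatim.
* `zariskiDim K S` is the Krull dimension of the coordinate ring of the Zariski closure of `S`,
  `MvPolynomial ι K ⧸ vanishingIdeal K S`, valued in `WithBot ℕ∞` (`⊥` for `S = ∅`).
* `IsDefinedOver F S` and `IsGenericOver F V z` use Mathlib's two-field `zeroLocus`/`vanishingIdeal`
  with coefficient field the subfield `↥F` (and its `Algebra ↥F K` instance).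
* `matrixAct M z` uses `zpow` on the multiplicative block; off `torusLocus` this involves Mathlib's
  junk convention `0⁻¹ = 0`. Every consumer (rotundity, exponential-algebraic closedness in C5)
  intersects with `torusLocus` first.
* Mathlib has no `IsRotund`/exponential-variety vocabulary (grep: `rotund`, `expGraph`: none); the
  Zariski-closed/irreducible predicates here are thin wrappers around `MvPolynomial.zeroLocus` and
  `Ideal.IsPrime`, kept as named `def`s because the C5 axioms quantify over them.
-/

open scoped BigOperators
open MvPolynomial

namespace Literature.NumberTheory.Transcendental

section Zariski

variable (K : Type*) [Field K] {ι : Type*}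

/-- The (Zariski) dimension of a subset `S ⊆ K^ι`: the Krull dimension of the coordinate ring
`K[X_ι] ⧸ I(S)` of its Zariski closure, in `WithBot ℕ∞` (so `dim ∅ = ⊥`).
Zilber 2005 §1; Marker 2006 §1. [cite: Zilber2005, §1] -/
noncomputable def zariskiDim (S : Set (ι → K)) : WithBot ℕ∞ :=
  ringKrullDim (MvPolynomial ι K ⧸ MvPolynomial.vanishingIdeal K S)

/-- `S ⊆ K^ι` is Zariski closed: it is the zero locus of some ideal of `K[X_ι]`.
Marker 2006 §1. [cite: Marker2006, §1] -/
def IsZariskiClosed (S : Set (ι → K)) : Prop :=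
  ∃ I : Ideal (MvPolynomial ι K), S = MvPolynomial.zeroLocus K I

/-- `S ⊆ K^ι` is an irreducible Zariski closed set (an affine variety): it is Zariski closed and
its vanishing ideal `I(S) ⊆ K[X_ι]` is prime (in particular `S ≠ ∅`). Zilber 2005 §1;
Marker 2006 §1. [cite: Zilber2005, §1] -/
def IsIrreducibleClosed (S : Set (ι → K)) : Prop :=
  IsZariskiClosed K S ∧ (MvPolynomial.vanishingIdeal K S).IsPrime

variable {K}

/-- `S ⊆ K^ι` is (closed and) defined over the subfield `F ≤ K`: it is the zero locus in `K^ι`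
of an ideal of polynomials with coefficients in `F`. Zilber 2005 §1; Kirby 2013 §2. [cite: Zilber2005, §1] -/
def IsDefinedOver (F : Subfield K) (S : Set (ι → K)) : Prop :=
  ∃ I : Ideal (MvPolynomial ι F), S = MvPolynomial.zeroLocus K I

/-- `z` is a generic point of `V` over the subfield `F ≤ K`: `z ∈ V` and the polynomials over `F`
vanishing at `z` are exactly those vanishing on `V` (textbook definition, Marker 2006 §1;
Zilber 2005 §3, "generic over `F`"). [cite: Marker2006, §1] -/
def IsGenericOver (F : Subfield K) (V : Set (ι → K)) (z : ι → K) : Prop :=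
  z ∈ V ∧ MvPolynomial.vanishingIdeal F ({z} : Set (ι → K)) = MvPolynomial.vanishingIdeal F V

/-- Zariski dimension is monotone: `S ⊆ T → dim S ≤ dim T` (the coordinate ring of the closure
of `S` is a quotient of that of `T`). Marker 2006 §1. [cite: Marker2006, §1] -/
theorem zariskiDim_mono {S T : Set (ι → K)} (h : S ⊆ T) : zariskiDim K S ≤ zariskiDim K T :=
  ringKrullDim_le_of_surjective
    (Ideal.Quotient.factor (MvPolynomial.vanishingIdeal_anti_mono h))
    (Ideal.Quotient.factor_surjective _)

/-- The empty set has Zariski dimension `⊥` (its coordinate ring is the zero ring). [folklore] -/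
@[simp] theorem zariskiDim_empty : zariskiDim K (∅ : Set (ι → K)) = ⊥ := by
  unfold zariskiDim
  haveI : Subsingleton (MvPolynomial ι K ⧸ MvPolynomial.vanishingIdeal K (∅ : Set (ι → K))) :=
    Ideal.Quotient.subsingleton_iff.mpr MvPolynomial.vanishingIdeal_empty
  exact ringKrullDim_eq_bot_of_subsingleton

/-- Over an infinite field, affine `ι`-space has Zariski dimension `#ι` (no nonzero polynomial
vanishes on all of `K^ι`, and `dim K[X_ι] = #ι`). Marker 2006 §1. [cite: Marker2006, §1] -/
def zariskiDim_univ : Prop :=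
  ∀ [Infinite K] [Fintype ι],
    zariskiDim K (Set.univ : Set (ι → K)) = Fintype.card ι

/-- A zero locus is Zariski closed. [folklore] -/
theorem isZariskiClosed_zeroLocus (I : Ideal (MvPolynomial ι K)) :
    IsZariskiClosed K (MvPolynomial.zeroLocus K I) :=
  ⟨I, rfl⟩

/-- A set defined over a subfield `F` is Zariski closed over `K`: `Z_K(I) = Z_K(I · K[X])`.
Kirby 2013 §2. [cite: Kirby2013, §2] -/
theorem IsDefinedOver.isZariskiClosed {F : Subfield K} {S : Set (ι → K)}
    (h : IsDefinedOver F S) : IsZariskiClosed K S := by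
  obtain ⟨I, rfl⟩ := h
  refine ⟨I.map (MvPolynomial.map (algebraMap F K)), ?_⟩
  ext x
  simp only [MvPolynomial.mem_zeroLocus_iff]
  constructor
  · intro hx p hp
    refine Submodule.span_induction (p := fun p _ => MvPolynomial.aeval x p = 0) ?_ ?_ ?_ ?_ hp
    · rintro _ ⟨q, hq, rfl⟩
      rw [MvPolynomial.aeval_map_algebraMap]
      exact hx q hq
    · simp
    · intro p q _ _ hp hq
      rw [map_add, hp, hq, add_zero]
    · intro a p _ hp
      rw [smul_eq_mul, map_mul, hp, mul_zero]
  · intro hx p hp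
    have := hx (MvPolynomial.map (algebraMap F K) p) (Ideal.mem_map_of_mem _ hp)
    rwa [MvPolynomial.aeval_map_algebraMap] at this

/-- A generic point of `V` over `F` avoids every proper `F`-closed subset of `V`
(the "geometric" reading of genericity; Marker 2006 §1, Zilber 2005 §3). [cite: Marker2006, §1  Zilber 2005 §3] -/
def IsGenericOver.not_mem_of_ssubset : Prop :=
  ∀ {F : Subfield K} {V W : Set (ι → K)} {z : ι → K} (hz : IsGenericOver F V z) (hW : IsDefinedOver F W) (hWV : W ⊂ V),
    z ∉ W

end Zariski

section Torus

variable (K : Type*) [Field K] (n : ℕ)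

/-- The locus `Kⁿ × (Kˣ)ⁿ ⊆ K^{n ⊕ n}`: points whose last `n` coordinates are nonzero.
Zilber 2005 §1 (`G_n(K) = 𝔾ₐⁿ × 𝔾ₘⁿ`). [cite: Zilber2005, §1 ( G_n(K] -/
def torusLocus : Set (Fin n ⊕ Fin n → K) :=
  {z | ∀ i, z (Sum.inr i) ≠ 0}

variable {K n}

/-- Membership in `torusLocus`. [folklore] -/
@[simp] theorem mem_torusLocus_iff {z : Fin n ⊕ Fin n → K} :
    z ∈ torusLocus K n ↔ ∀ i, z (Sum.inr i) ≠ 0 :=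
  Iff.rfl

/-- The action of an integer matrix `M ∈ Mₙ(ℤ)` on `Kⁿ × (Kˣ)ⁿ`: additively (`x ↦ M x`) on the
first block and multiplicatively (`y ↦ y^M`, `(y^M)_i = ∏ j, y_j ^ M i j`) on the second.
Zilber 2005 §2 (`[M] : G_n → G_n`); Kirby 2013 §2.

**Junk value.** The multiplicative block uses `zpow`, so off `torusLocus` (some `y_j = 0`) a
negative exponent produces Mathlib's convention `0⁻¹ = 0`; every consumer intersects with
`torusLocus` first. [cite: Zilber2005, §2 (  M] -/
noncomputable def matrixAct (M : Matrix (Fin n) (Fin n) ℤ) (z : Fin n ⊕ Fin n → K) :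
    Fin n ⊕ Fin n → K :=
  Sum.elim (fun i => ∑ j, (M i j : K) * z (Sum.inl j)) (fun i => ∏ j, z (Sum.inr j) ^ M i j)

/-- Additive coordinates of `matrixAct`. [folklore] -/
@[simp] theorem matrixAct_inl (M : Matrix (Fin n) (Fin n) ℤ) (z : Fin n ⊕ Fin n → K) (i : Fin n) :
    matrixAct M z (Sum.inl i) = ∑ j, (M i j : K) * z (Sum.inl j) :=
  rfl

/-- Multiplicative coordinates of `matrixAct`. [folklore] -/
@[simp] theorem matrixAct_inr (M : Matrix (Fin n) (Fin n) ℤ) (z : Fin n ⊕ Fin n → K) (i : Fin n) :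
    matrixAct M z (Sum.inr i) = ∏ j, z (Sum.inr j) ^ M i j :=
  rfl

/-- The identity matrix acts as the identity. [folklore] -/
@[simp] theorem matrixAct_one (z : Fin n ⊕ Fin n → K) : matrixAct (1 : Matrix (Fin n) (Fin n) ℤ) z = z := by
  ext (i | i)
  · simp [Matrix.one_apply]
  · simp [Matrix.one_apply]

/-- `matrixAct` preserves the torus locus. [folklore] -/
theorem matrixAct_mem_torusLocus (M : Matrix (Fin n) (Fin n) ℤ) {z : Fin n ⊕ Fin n → K}
    (hz : z ∈ torusLocus K n) : matrixAct M z ∈ torusLocus K n := by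
  intro i
  simp only [matrixAct_inr]
  exact Finset.prod_ne_zero_iff.mpr fun j _ => zpow_ne_zero _ (hz j)

/-- On the torus locus the action is multiplicative: `[M N] z = [M] ([N] z)`.
Zilber 2005 §2. (Off `torusLocus` this fails because of the `0⁻¹ = 0` junk value.) [cite: Zilber2005, §2. (Off  torusLocus  this fails because] -/
def matrixAct_mul : Prop :=
  ∀ (M N : Matrix (Fin n) (Fin n) ℤ) {z : Fin n ⊕ Fin n → K} (hz : z ∈ torusLocus K n),
    matrixAct (M * N) z = matrixAct M (matrixAct N z)

variable (K n) in
/-- `V ⊆ Kⁿ × (Kˣ)ⁿ` is *rotund* (Zilber's "ex-normal"): for every integer matrix `M`,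
`dim [M](V) ≥ rank M`. Zilber 2005 §3; Kirby 2013 Def. 2.6; Bays–Kirby 2018 §2. [cite: Zilber2005, §3] -/
def IsRotund (V : Set (Fin n ⊕ Fin n → K)) : Prop :=
  ∀ M : Matrix (Fin n) (Fin n) ℤ,
    ((M.map (Int.cast : ℤ → ℚ)).rank : WithBot ℕ∞) ≤ zariskiDim K (matrixAct M '' V)

variable (K n) in
/-- `V` is *additively free*: no nontrivial `ℤ`-linear combination `∑ mᵢ xᵢ` of the additive
coordinates is constant on `V`. Zilber 2005 §3; Kirby 2013 Def. 2.6. [cite: Zilber2005, §3] -/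
def IsAddFree (V : Set (Fin n ⊕ Fin n → K)) : Prop :=
  ∀ m : Fin n → ℤ, m ≠ 0 → ¬ ∃ c : K, ∀ z ∈ V, ∑ i, (m i : K) * z (Sum.inl i) = c

variable (K n) in
/-- `V` is *multiplicatively free*: no nontrivial monomial `∏ yᵢ ^ mᵢ` (`m ∈ ℤⁿ ∖ {0}`) in the
multiplicative coordinates is constant on `V`. Zilber 2005 §3; Kirby 2013 Def. 2.6. [cite: Zilber2005, §3] -/
def IsMulFree (V : Set (Fin n ⊕ Fin n → K)) : Prop :=
  ∀ m : Fin n → ℤ, m ≠ 0 → ¬ ∃ c : K, ∀ z ∈ V, ∏ i, z (Sum.inr i) ^ m i = c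

/-- The whole torus locus `Kⁿ × (Kˣ)ⁿ` is rotund (over an infinite field): `[M]` maps it onto a
set of dimension `n + rank M ≥ rank M`. Zilber 2005 §3. [cite: Zilber2005, §3] -/
def isRotund_torusLocus : Prop :=
  ∀ [Infinite K],
    IsRotund K n (torusLocus K n)

end Torus

section Exp

variable (K : Type*) [Field K] [Literature.ModelTheory.ExponentialFields.ExponentialRing K] (n : ℕ)

/-- The graph of (coordinatewise) exponentiation in `Kⁿ × Kⁿ`:
`{(x, y) | ∀ i, yᵢ = exp xᵢ}`. Zilber 2005 §1. [cite: Zilber2005, §1] -/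
def expGraph : Set (Fin n ⊕ Fin n → K) :=
  {z | ∀ i, z (Sum.inr i) = Literature.ModelTheory.ExponentialFields.ExponentialRing.exp (z (Sum.inl i))}

variable {K n}

/-- Membership in `expGraph`. [folklore] -/
@[simp] theorem mem_expGraph_iff {z : Fin n ⊕ Fin n → K} :
    z ∈ expGraph K n ↔ ∀ i, z (Sum.inr i) = Literature.ModelTheory.ExponentialFields.ExponentialRing.exp (z (Sum.inl i)) :=
  Iff.rfl

/-- The graph of exponentiation lies in the torus locus, since `exp x` is a unit. [folklore] -/
theorem expGraph_subset_torusLocus : expGraph K n ⊆ torusLocus K n := fun z hz i => by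
  rw [hz i]
  exact (Literature.ModelTheory.ExponentialFields.ExponentialRing.isUnit_exp _).ne_zero

/-- The graph of exponentiation is stable under the action of integer matrices:
`exp (∑ j, M i j • x j) = ∏ j, (exp (x j)) ^ M i j`. Zilber 2005 §2. [cite: Zilber2005, §2] -/
def matrixAct_mem_expGraph : Prop :=
  ∀ (M : Matrix (Fin n) (Fin n) ℤ) {z : Fin n ⊕ Fin n → K} (hz : z ∈ expGraph K n),
    matrixAct M z ∈ expGraph K n

end Exp

end Literature.NumberTheory.Transcendental
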